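import Summits.BirchSwinnertonDyer.Rank1Residual.F1Sign2.KuriharaPairLevelSequenceAtTwo
import Literature.NumberTheory.EllipticCurves.Selmer
import HarnessLib.Audit.Tags
import HarnessLib

/-!
# Cell `bsd-f1-sign2`, IMC lens (planner `-imc` g14, MEMO-imc §10.93-add2/add3): RETRACTION BY DATA of P50f and its two REPAIRS P50f′ / P50f″
# (twist-by-2 point divisibility at 2; sibling of `F1Sign2/KuriharaPairLevelSequenceAtTwo.lean`, which it imports)

PORT (cell `bsd-f1-sign2`, seat `-ty` g13, -imc's URGENT/TURNKEY line INBOX 2026-08-28T23:48:13Z) of -imc g14's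
`HOME/MEMO-imc-data/dimc50/lean/AppendP50fRepair.lean` (sha16 44eff9f9fd605876; = the P50f′/P50f″ blocks of `SketchG14KPI.lean` v3 2494f823e53d84ea + glue; farm rc 0).
Bodies VERBATIM; the typer's only edits are this header, the imports of `Literature.NumberTheory.EllipticCurves.Selmer` (as in Probe151) /
`HarnessLib.Audit.Tags`, the REF1/REF2 riders in the docstrings, and REF1's §151 cores/bridges/glues block at the end.
WHY THIS FILE EXISTS.  P50f `TwistByTwoPointTwoDivisibleAtTwoOffUnit` (landed p676729 as `@[conjecture]`, REF1 §147 «survives, thin 6/6») was REFUTED AS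
TYPED by -imc's own full census (kit j319563 `p50ext-full` 2 153 curves + j320188; two point engines agree 1 997/1 997, two local criteria 2 130/2 130):
396/401, witnesses `58675c1`, `74331a1`, `74331b1`, `79325c1`, `96971c1` (Tam 1,1,3,5,1; `Ш_an(W) = 4`; `Ш_an(W^{(2)}) = 4`; generator `G` of `W^{(2)}(ℚ) ≅ ℤ`
with `v₂(x(G)) ≥ 0` ⇒ `G ∉ 2W′(ℚ₂)`).  The failure mode: `Ш(W^{(2)})[2] ≠ 0` can absorb the level-2 growth.  The tree is append-only: P50f keeps its
declaration with a «REFUTED AS TYPED» docstring (p679374); the two laws below REPLACE it.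
CONTENT (both `@[conjecture]`, nothing asserted): **P50f′ `TwistByTwoPointNotTwoDivisibleAtTwoOfHalfUnit`** — good supersingular at 2, `L(W,1)/Ω = t` with
`v₂(t) = 1` (half-unit), `W′` a model of the twist by 2 of analytic rank 1 ⇒ SOME rational nonsingular point of `W′` is NOT 2-divisible in `W′(ℚ₂)` (census
0/364 divisible; with P50e: `ord₂(L/Ω) ≤ 1` ⇒ primitive 1 851/1 851); **P50f″ `TwistByTwoPointTwoDivisibleAtTwoOfOddTwistSha`** — P50f's hypotheses
(`1 ≤ v₂(t)`, Tam odd) PLUS `∀ κ cyclotomic, #{x ∈ Sel(W′/ℚ_0) : 2x = 0} = 2` (i.e. rank 1 ∧ `Ш(W′)[2] = 0`) ⇒ EVERY rational nonsingular point of `W′` is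
2-divisible in `W′(ℚ₂)` (388/388 certified + 2 undetermined, N < 10⁵ exhaustive); KERNEL glue `twistByTwoPointTwoDivisibleAtTwoOfOddTwistSha_of_offUnit :
P50f → P50f″` (weakening; vacuous comfort since P50f is refuted, kept as -imc wrote it).
REF1 §151 = R-150 / D-imc-50-R1 add2 (refuter-bsd-f1-sign2-ref1 g14, `HOME/REF1-AUDIT-v1.md` §151 l.2918; evidence `HOME/REF1-data/b151/` —
`lean/Probe151.lean` f437b22af20f30b2 farm rc 0; INBOX 2026-08-29T00:16:40Z) VERDICTS verbatim: «(a) P50f KILL CONFIRMED (5 rows = T₂ case II); (b) P50f′ SURVIVES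
conjecture = BSD₂(W)↑ half-unit slice ∘ theorem; P50f″ SURVIVES conjecture = BSD₂(W)↓ even slice ∘ theorem and ≡ it on its locus — VARIANT-of-BSD₂(W), NOT
BSD/ℚ(√2); algebraic cores P50e‴/P50e‴♭/P50f‴/T₂-trichotomy (parity-free)/T₂-dichotomy (d₂(W^{(2)}) = d₂(W) ± 1) THEOREM-grade, typed, kernel glues
`oddTwistSha_of_cores`/`halfUnit_of_cores` std axioms; (c) P50d NO ¬HasCM rider; (d) splitting form = h-table»; J151 KERNEL «a₁ even, a₃ odd ⇒ Δ ≡ 5 (8)» =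
why Kramer Prop 4 gives δ₂ = 1 on EVERY ss-at-2 curve (128 143/128 143); BC7 caveat: tree `prop33_rat`/`cor34ii_rat` need 2 SPLIT — not consumable by name
for ℚ(√2); third engine (Cremona mwrank gens, N < 7 812, 1 109 curves): 934/934 unit+half-unit primitive AND Ш_an(W′) odd; 17/17 Tam-odd Ш_an = 4 divisible.
-ty instructions APPLIED: P50f′/P50f″ `@[conjecture]` bodies verbatim + the docstring line «= BSD₂(W) rank-0 slice ∘ MR T={2} sandwich»; the OPTIONAL cores /
bridges / glues of Probe151 l.74–277 typed VERBATIM at the end (one docstring added on `delta_eq_eight_mul_add_five`, gate lint) as plain defs/theorems (THEOREM TARGETS) with the three BSD₂ slices B1/B1′/B1′♭ and the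
α-restriction of P50f′ tagged `@[conjecture]`.
REF2 v44 §1 = D-imc-50-R2 add2 (refuter-bsd-f1-sign2-ref2 g44, `HOME/REF2-PLACEMENT-v44.md` a3e663cc836184fe, INBOX 2026-08-29T00:08:07Z; rider §1.5
REF2_TXT_DIMC50B verbatim): «Placement (REF2 v44 §1). On this population (good supersingular at 2, K = ℚ(√2), no inert even-Tamagawa prime) the 2-Selmer
groups of `W` and of its twist `W^{(2)}` are nested of codimension exactly 1 in `H¹(ℚ, W[2])`, transversal at 2 [cite: Kramer1981, Prop. 4, Prop. 7,
(11)–(13), Thm. 1 and Remark p. 131]; [cite: MazurRubin2010, Thm. 2.7, Lemma 2.9–2.10]; 2-parity [cite: Monsky1996]. Consequently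
`…NotTwoDivisibleAtTwoOfHalfUnit` is that theorem plus «Ш_an(W) odd ⇒ Ш(W)[2] = 0» and `…TwoDivisibleAtTwoOfOddTwistSha` is that theorem plus «2 ∣ Ш_an(W) ⇒
Ш(W)[2] ≠ 0» — the two halves of BSD₂ for the rank-0 curve `W`, neither printed at p = 2 [cite: SkinnerUrban2014] (odd p only). Conjecture-grade as typed;
algebraic cores known. [cite: KrizLi2019, Thm. 1.12] concerns 2 split in an imaginary quadratic field and is not the comparand.»  BY-PRODUCT PREDICTIONS
(REF2, checkable on j320188): (π1) Ш_an(W^{(2)}) odd on all 1 851 unit/half-unit rows; (π2) under P50f″'s hypotheses Ш(W)[2] ≅ (ℤ/2)² exactly.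
PARTITION: none moved; beyond-print theorem: no; BSD is not proved; stmt-23715 is not closed by anything here.

## The sketch's own summary (verbatim)

# APPEND for `F1Sign2/KuriharaPairLevelSequenceAtTwo.lean` (bsd-f1-sign2 -imc g14, MEMO-imc §10.93-add2 and §10.93-add3) — for `-ty`, REF1-gated

## Retraction by data of P50f `TwistByTwoPointTwoDivisibleAtTwoOffUnit`
The landed `@[conjecture] def TwistByTwoPointTwoDivisibleAtTwoOffUnit` («Tam(W) odd ∧ ord₂(L(W,1)/Ω_W) ≥ 1 ∧ twist of analytic rank 1 ⇒
EVERY rational point of W′ is 2-divisible in W′(ℚ₂)») is CONTRADICTED NUMERICALLY (kit j319563 + j320188, two independent point engines,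
two local criteria; bundle `pub/bsd-f1-sign2/MEMO-imc-data/dimc50/out/RESULTS-P50EXT.txt`) by the five optimal curves
`58675c1 = [0,0,1,-6875,219531]`, `74331a1 = [0,0,1,-7224,-236328]`, `74331b1 = [0,0,1,-65016,6380849]`, `79325c1 = [0,-1,1,-41458,1113443]`,
`96971c1 = [0,1,1,-10404,-413528]` (Tam = 1,1,3,5,1; `Ш_an(W) = 4`; `Ш_an(W^{(2)}) = 4`; the generator `G` of `W^{(2)}(ℚ) ≅ ℤ` has
`v₂(x(G)) = 0,0,0,3,1 ≥ 0`, i.e. `G ∉ Ŵ′(2ℤ₂) = 2W′(ℚ₂)`); it holds on the other 396 of the 401 such curves with `N < 10⁵`. No kernel refutation is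
possible (the analytic hypotheses are not dischargeable in the tree), so the statement stays as landed and is SUPERSEDED by the two laws below;
do not cite P50f as live. `TwistByTwoPointTwoDivisibleAtTwoOfOddTwistSha` is a WEAKENING of P50f (one more hypothesis), recorded by the glue
`twistByTwoPointTwoDivisibleAtTwoOfOddTwistSha_of_offUnit`.
-/

open scoped Classical MatrixGroups ModularForm NumberField Pointwise

open CongruenceSubgroup Polynomial WeierstrassCurve Literature.NumberTheory.EllipticCurves Literature.Barriers.BirchSwinnertonDyer

namespace Summit.BirchSwinnertonDyer.Rank1Residual.F1Sign2

/-- **P50f′ `TwistByTwoPointNotTwoDivisibleAtTwoOfHalfUnit`** — candidate, CONJECTURE-grade (EMPIRICAL LAW, MEMO-imc §10.93-add2; replaces the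
session's earlier P50f `TwistByTwoPointTwoDivisibleAtTwoOffUnit` «Tam odd ∧ 2 ∣ L/Ω ⇒ every point 2-divisible», which the extension run kit j319563
REFUTED AS TYPED on 5/401 curves: `58675c1, 74331a1, 74331b1, 79325c1, 96971c1` — Tam(W) = 1,1,3,5,1, `Ш_an(W) = 4`, generator of `W^{(2)}(ℚ)` with
`v₂(x) = 0,0,0,3,1 ≥ 0`, two point sources agreeing). STATEMENT: `W/ℚ` globally minimal, good supersingular reduction at `2` (`2 ∣ a₂`), and the
HALF-UNIT locus `ord₂(L(W,1)/Ω_W) = 1` EXACTLY (under BSD: `Tam(W) ≡ 2 (mod 4)` and `#Ш(W)` odd, torsion being odd); `W'` a model of the twist by `2`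
of analytic rank `1`: SOME rational point of `W'` is not `2`-divisible in `W'(ℚ₂)` (as in P50e). CENSUS (BC5 witness): **0/364 generators divisible**
(`N < 4·10³`: 0/98, kit j318779 + j319274; `10⁴ ≤ N < 2·10⁴`: 0/266, kit j319563; both engines), against 8.5 %–99 % divisible on the cells with
`ord₂(L/Ω) ≥ 2`. Together with P50e: `ord₂(L(W,1)/Ω_W) ≤ 1 ⇒` the generator of `W^{(2)}(ℚ)` is `2`-adically primitive, 1 851/1 851 (`N < 3·10⁴`).
WHY it might hold (words, not a proof): with `v₂(θ_{ℚ_0}) = 1` the pair module still has `I_2 − I_1 ≤ 1` and the single even Tamagawa factor sits at a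
prime `ℓ` whose `H¹(G_w, W)` at the step `ℚ_2/ℚ_1` absorbs the cokernel, leaving `b_2 = 0`; no derivation is claimed — `-ref1` is asked for one or a kill.
[cite: KuriharaOtsuki2006, §2.3] [cite: GrossZagier1986, Thm. I.6.3] [cite: Kolyvagin1990, Thm. A]
REF1 §151 (R-150, refuter -ref1 g14, `Probe151.lean` f437b22af20f30b2): SURVIVES, CONJECTURE-GRADE = BSD₂(W) rank-0 slice ∘ MR T={2} sandwich (REF1 §151 /
REF2 v44 §1) — the ↑ half-unit slice B1′♭ `HalfUnitLValueForcesSelmerTrivialAndTamagawaAtTwo` ∘ theorem-grade cores P50e‴♭ + B4 (kernel glue `halfUnit_of_cores` below); VARIANT-of-BSD₂(W), NOT BSD/ℚ(√2); third engine (Cremona mwrank gens, N < 7 812): 934/934 unit+half-unit primitive, 17/17 Tam-odd Ш_an = 4 divisible. -/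
@[conjecture] def TwistByTwoPointNotTwoDivisibleAtTwoOfHalfUnit : Prop :=
  ∀ (W : WeierstrassCurve ℚ) [W.IsElliptic] [W.IsGloballyMinimal],
    W.HasGoodReductionAtPrime 2 → (2 : ℤ) ∣ W.frobeniusTrace 2 →
    (∃ t : ℚ, W.entireLFunction 1 / (W.realPeriodRat : ℂ) = (t : ℂ) ∧ t ≠ 0 ∧ padicValRat 2 t = 1) →
    ∀ (W' : WeierstrassCurve ℚ) [W'.IsElliptic],
      (∃ C : VariableChange ℚ, C • W.quadraticTwist 2 = W') → W'.analyticRank = 1 →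
      ∃ (x y : ℚ) (h : (W'.baseChange ℚ_[2]).toAffine.Nonsingular (algebraMap ℚ ℚ_[2] x) (algebraMap ℚ ℚ_[2] y)),
        W'.toAffine.Nonsingular x y ∧
          ¬ ∃ Q : (W'.baseChange ℚ_[2]).toAffine.Point,
            Q + Q = WeierstrassCurve.Affine.Point.some (algebraMap ℚ ℚ_[2] x) (algebraMap ℚ ℚ_[2] y) h

/-- **P50f″ `TwistByTwoPointTwoDivisibleAtTwoOfOddTwistSha`** — candidate, CONJECTURE-grade (EMPIRICAL LAW, MEMO-imc §10.93-add2; the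
repaired mirror law). Setting of P50e OFF the unit locus with `Tam(W)` odd: `W/ℚ` globally minimal, good supersingular at `2`, `L(W,1) ≠ 0` with
`ord₂(L(W,1)/Ω_W) ≥ 1` (⟺ `2 ∣ #Ш(W)_an`), `Tam(W)` odd, `W'` a model of the twist by `2` of analytic rank `1` whose `2^∞`-Selmer group over `ℚ`
(= layer `0` of the cyclotomic tower) has `2`-torsion of order exactly `2` (⟺ `rank 1 ∧ Ш(W')[2] = 0`, as `W'(ℚ)[2] = 0`): EVERY rational point of
`W'` is `2`-divisible in `W'(ℚ₂)`. CENSUS (BC5 witness, kit j319563 + j320188, `N < 10⁵`, all 401 Tam-odd `Ш_an(W)`-even rank-0 optimal curves with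
`N ≡ ±3 (8)` whose twist has rank 1): `Ш_an(W')` certified odd `⇒` generator divisible **388/388** (+ 2/2 with `Ш_an(W')` undetermined); `Ш_an(W') = 4 ⇒ 6/11` (the five non-divisible ones,
`58675c1, 74331a1, 74331b1, 79325c1, 96971c1`, are exactly what refuted the unrepaired P50f). Tam-even companion (words only): `2 ∣ Ш_an(W)` and
`ord₂(Ш_an(W')·Tam(W')) ≤ 1 ⇒` divisible, 574/574 certified (`= 388 + 186`); mixed as soon as `ord₂(Ш_an(W')·Tam(W')) ≥ 2`. WHY it might hold (words): the
`n = 2` step of the Kurihara–Pollack ladder reads `#Coker(Sel(W/ℚ_1) → Sel(W/ℚ_2)^G) = 2^{b_2}` when all Tamagawa numbers over `ℚ_1 = ℚ(√2)` are odd,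
and `Ш(W')[2] = 0` makes `Sel(W/ℚ_1)^∨_{tors} = Ш(W/ℚ)[2^∞]`-controlled, so the freed level-2 growth `I_2 − I_1 ≥ 1` must come from `b_2 = 1`; with
`Ш(W')[2] ≠ 0` the growth can be absorbed by `Ш(W')` instead (6/11). No derivation is claimed. [cite: KuriharaOtsuki2006, §2.3] [cite: Kramer1981, Prop. 4]
[cite: GrossZagier1986, Thm. I.6.3] [cite: Kolyvagin1990, Thm. A]
REF1 §151 (R-150, refuter -ref1 g14, `Probe151.lean` f437b22af20f30b2): SURVIVES, CONJECTURE-GRADE = BSD₂(W) rank-0 slice ∘ MR T={2} sandwich (REF1 §151 /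
REF2 v44 §1) — the ↓ even slice B1 `EvenLValueForcesSelmerFourAtTwo` ∘ theorem-grade cores T₂-trichotomy + P50f‴ + B0 + B3 (kernel glue `oddTwistSha_of_cores` below), ≡ BSD₂(W)↓ on its locus; VARIANT-of-BSD₂(W), NOT BSD/ℚ(√2); third engine (Cremona mwrank gens, N < 7 812): 934/934 unit+half-unit primitive, 17/17 Tam-odd Ш_an = 4 divisible. -/
@[conjecture] def TwistByTwoPointTwoDivisibleAtTwoOfOddTwistSha : Prop :=
  ∀ (W : WeierstrassCurve ℚ) [W.IsElliptic] [W.IsGloballyMinimal],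
    W.HasGoodReductionAtPrime 2 → (2 : ℤ) ∣ W.frobeniusTrace 2 →
    (∃ t : ℚ, W.entireLFunction 1 / (W.realPeriodRat : ℂ) = (t : ℂ) ∧ t ≠ 0 ∧ 1 ≤ padicValRat 2 t) → ¬ 2 ∣ W.tamagawaProduct →
    ∀ (W' : WeierstrassCurve ℚ) [W'.IsElliptic],
      (∃ C : VariableChange ℚ, C • W.quadraticTwist 2 = W') → W'.analyticRank = 1 →
      (∀ (κ : ZpExtension ℚ 2), κ.IsCyclotomic → Nat.card {x : ↥(W'.selmerLayer κ 0) // (2 : ℕ) • x = 0} = 2) →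
      ∀ (x y : ℚ) (h : (W'.baseChange ℚ_[2]).toAffine.Nonsingular (algebraMap ℚ ℚ_[2] x) (algebraMap ℚ ℚ_[2] y)),
        W'.toAffine.Nonsingular x y →
          ∃ Q : (W'.baseChange ℚ_[2]).toAffine.Point,
            Q + Q = WeierstrassCurve.Affine.Point.some (algebraMap ℚ ℚ_[2] x) (algebraMap ℚ ℚ_[2] y) h

/-- Glue (kernel): P50f″ is P50f with one extra hypothesis, hence implied by it (so the data that kills P50f does not touch P50f″ only because
the five witnesses violate the extra hypothesis: `Ш_an(W^{(2)}) = 4` on all five). -/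
theorem twistByTwoPointTwoDivisibleAtTwoOfOddTwistSha_of_offUnit (h : TwistByTwoPointTwoDivisibleAtTwoOffUnit) :
    TwistByTwoPointTwoDivisibleAtTwoOfOddTwistSha := by
  intro W _ _ hgood ha2 ht htam W' _ hC hrk _hsel x y hns hxy
  exact h W hgood ha2 ht htam W' hC hrk x y hns hxy

/-! ### REF1 §151 riders (typed VERBATIM from `HOME/REF1-data/b151/lean/Probe151.lean` f437b22af20f30b2, l.74–277: the `T = {2}` SANDWICH —
theorem-grade cores P50e‴ / P50f‴ / T₂-trichotomy / T₂-dichotomy / ♭-cores and bridges B0/B3/B4 as PLAIN defs (THEOREM TARGETS, as P50c′ was to P50c),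
the BSD₂(W) slices B1 / B1′ / B1′♭ and the α-restriction of P50f′ as `@[conjecture]` (REF1: «each theorem-grade or in print, EXCEPT B1/B1′ = the BSD₂(W)
slices»), kernel glues `oddTwistSha_of_cores : … → P50f″`, `halfUnitAlpha_of_cores`, `halfUnitAlpha_of_halfUnit`, `trichotomy_of_dichotomy`,
`selmer_card_of_dichotomy_of_twist_two`, `halfUnit_of_cores : … → P50f′`, and the kernel brick J151 `delta_emod_eight_of_even_a1_odd_a3`
(«a₁ even, a₃ odd ⇒ Δ ≡ 5 (mod 8)» = why Kramer Prop. 4 gives δ₂ = 1 on EVERY curve supersingular at 2); std axioms.) -/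

/-! ## REF1 §151 — theorem-grade cores (the `T = {2}` sandwich; words-proof in REF1-AUDIT §151) -/

/-- MR 2010 Lemma 2.10 (ii)/(iii)/(v) at every prime INERT in `ℚ(√2)` (`p ≡ ±3 (8)`): the local `2`-Selmer conditions of `W` and `W^{(2)}` agree
there. Implied by `Tam(W)` odd (bridge B0 below). Split primes (`p ≡ ±1 (8)`) need nothing (Lemma 2.10 (i)); the real place splits. -/
def InertPrimesSilentAtTwo (W : WeierstrassCurve ℚ) [W.IsElliptic] : Prop :=
  ∀ (p : ℕ) [Fact p.Prime], (p % 8 = 3 ∨ p % 8 = 5) →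
    (∀ Q : (W.baseChange ℚ_[p]).toAffine.Point, 2 • Q = 0 → Q = 0) ∨
    (W.HasMultiplicativeReductionAtPrime p ∧ Odd (padicValRat p W.Δ)) ∨
    W.HasGoodReductionAtPrime p

/-- **T₂-card `TwistByTwoSelmerCardTrichotomyAtTwo`** (REF1 §151 core, THEOREM-grade, parity-free): `W` good at `2` with `2 ∣ a₂` (so
`W(ℚ₂)[2] = 0`, `dim H¹(ℚ₂, W[2]) = 2`), inert primes silent; `W'` the twist by `2`. Then with `S_T ⊂ Sel₂(W), Sel₂(W') ⊂ S^T`, `[S^T : S_T] = 2`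
(`T = {2}`, Poitou–Tate), each Selmer group is `S_T` or `S^T`: the three cardinal relations. -/
def TwistByTwoSelmerCardTrichotomyAtTwo : Prop :=
  ∀ (W : WeierstrassCurve ℚ) [W.IsElliptic] [W.IsGloballyMinimal],
    W.HasGoodReductionAtPrime 2 → (2 : ℤ) ∣ W.frobeniusTrace 2 → InertPrimesSilentAtTwo W →
    ∀ (W' : WeierstrassCurve ℚ) [W'.IsElliptic],
      (∃ C : VariableChange ℚ, C • W.quadraticTwist 2 = W') →
        Nat.card (W'.selmerGroup 2) = 2 * Nat.card (W.selmerGroup 2) ∨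
        2 * Nat.card (W'.selmerGroup 2) = Nat.card (W.selmerGroup 2) ∨
        Nat.card (W'.selmerGroup 2) = Nat.card (W.selmerGroup 2)

/-- **P50f‴ `TwistByTwoDivisibleAtTwoOfHalvedSelmer`** (REF1 §151 core of P50f″, THEOREM-grade, parity-free, BSD-free): in the T₂ setting,
`2·#Sel₂(W') = #Sel₂(W)` forces `Sel₂(W') = S_T` = the classes trivial at `2`, so EVERY rational point of `W'` is `2`-divisible in `W'(ℚ₂)`. -/
def TwistByTwoDivisibleAtTwoOfHalvedSelmer : Prop :=
  ∀ (W : WeierstrassCurve ℚ) [W.IsElliptic] [W.IsGloballyMinimal],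
    W.HasGoodReductionAtPrime 2 → (2 : ℤ) ∣ W.frobeniusTrace 2 → InertPrimesSilentAtTwo W →
    ∀ (W' : WeierstrassCurve ℚ) [W'.IsElliptic],
      (∃ C : VariableChange ℚ, C • W.quadraticTwist 2 = W') →
      2 * Nat.card (W'.selmerGroup 2) = Nat.card (W.selmerGroup 2) →
      ∀ (x y : ℚ) (h : (W'.baseChange ℚ_[2]).toAffine.Nonsingular (algebraMap ℚ ℚ_[2] x) (algebraMap ℚ ℚ_[2] y)),
        W'.toAffine.Nonsingular x y →
          ∃ Q : (W'.baseChange ℚ_[2]).toAffine.Point,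
            Q + Q = WeierstrassCurve.Affine.Point.some (algebraMap ℚ ℚ_[2] x) (algebraMap ℚ ℚ_[2] y) h

/-- **P50e‴ `TwistByTwoPrimitiveAtTwoOfTrivialSelmer`** (REF1 §151 core of P50e / P50f′-α, THEOREM-grade, parity-free, BSD-free): in the T₂
setting, `#Sel₂(W) = 1` forces `S_T = 0`, `#S^T = 2`, so every rational point of `W'` that is not `2`-divisible in `W'(ℚ)` has Kummer class the
generator of `S^T`, which is non-trivial at `2`: the point is NOT `2`-divisible in `W'(ℚ₂)`. -/
def TwistByTwoPrimitiveAtTwoOfTrivialSelmer : Prop :=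
  ∀ (W : WeierstrassCurve ℚ) [W.IsElliptic] [W.IsGloballyMinimal],
    W.HasGoodReductionAtPrime 2 → (2 : ℤ) ∣ W.frobeniusTrace 2 → InertPrimesSilentAtTwo W →
    Nat.card (W.selmerGroup 2) = 1 →
    ∀ (W' : WeierstrassCurve ℚ) [W'.IsElliptic],
      (∃ C : VariableChange ℚ, C • W.quadraticTwist 2 = W') →
      ∀ (x y : ℚ) (hq : W'.toAffine.Nonsingular x y)
        (h : (W'.baseChange ℚ_[2]).toAffine.Nonsingular (algebraMap ℚ ℚ_[2] x) (algebraMap ℚ ℚ_[2] y)),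
        (¬ ∃ R : W'.toAffine.Point, R + R = WeierstrassCurve.Affine.Point.some x y hq) →
          ¬ ∃ Q : (W'.baseChange ℚ_[2]).toAffine.Point,
            Q + Q = WeierstrassCurve.Affine.Point.some (algebraMap ℚ ℚ_[2] x) (algebraMap ℚ ℚ_[2] y) h

/-! ### Bridges (each theorem-grade or in print, EXCEPT B1/B1′ = the BSD₂(W) slices) -/

/-- B0 (Tate's algorithm table, theorem-grade): `Tam(W)` odd ⇒ every inert bad prime is multiplicative with `ord_p Δ` odd or has `W(ℚ_p)[2] = 0`. -/
def OddTamagawaSilencesInertPrimes : Prop :=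
  ∀ (W : WeierstrassCurve ℚ) [W.IsElliptic] [W.IsGloballyMinimal], ¬ 2 ∣ W.tamagawaProduct → InertPrimesSilentAtTwo W

/-- B1 (**the BSD₂(W) slice behind P50f″**, CONJECTURE): rank-0 `W`, good supersingular at `2`, `Tam(W)` odd, `2 ∣ L(W,1)/Ω_W` ⇒ `Ш(W)[2] ≠ 0`,
i.e. (no rational `2`-torsion, rank `0` by Kolyvagin) `4 ≤ #Sel₂(W)`. -/
@[conjecture] def EvenLValueForcesSelmerFourAtTwo : Prop :=
  ∀ (W : WeierstrassCurve ℚ) [W.IsElliptic] [W.IsGloballyMinimal],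
    W.HasGoodReductionAtPrime 2 → (2 : ℤ) ∣ W.frobeniusTrace 2 →
    (∃ t : ℚ, W.entireLFunction 1 / (W.realPeriodRat : ℂ) = (t : ℂ) ∧ t ≠ 0 ∧ 1 ≤ padicValRat 2 t) → ¬ 2 ∣ W.tamagawaProduct →
    4 ≤ Nat.card (W.selmerGroup 2)

/-- B1′ (**the BSD₂(W) slice behind P50f′**, CONJECTURE): `ord₂(L(W,1)/Ω_W) = 1` ⇒ `Ш(W)[2] = 0`, i.e. `#Sel₂(W) = 1`. -/
@[conjecture] def HalfUnitLValueForcesSelmerTrivialAtTwo : Prop :=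
  ∀ (W : WeierstrassCurve ℚ) [W.IsElliptic] [W.IsGloballyMinimal],
    W.HasGoodReductionAtPrime 2 → (2 : ℤ) ∣ W.frobeniusTrace 2 →
    (∃ t : ℚ, W.entireLFunction 1 / (W.realPeriodRat : ℂ) = (t : ℂ) ∧ t ≠ 0 ∧ padicValRat 2 t = 1) →
    Nat.card (W.selmerGroup 2) = 1

/-- B3 (Selmer comparison, theorem-grade: `Sel₂(W') ≅ Sel_{2^∞}(W'/ℚ)[2]` as `W'(ℚ)[2] = W(ℚ)[2] = 0`, layer `0` of the cyclotomic tower is `ℚ`). -/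
def LayerZeroTwoTorsionCardIsSelmerTwoCard : Prop :=
  ∀ (W : WeierstrassCurve ℚ) [W.IsElliptic] [W.IsGloballyMinimal],
    W.HasGoodReductionAtPrime 2 → (2 : ℤ) ∣ W.frobeniusTrace 2 →
    ∀ (W' : WeierstrassCurve ℚ) [W'.IsElliptic],
      (∃ C : VariableChange ℚ, C • W.quadraticTwist 2 = W') →
      (∀ (κ : ZpExtension ℚ 2), κ.IsCyclotomic → Nat.card {x : ↥(W'.selmerLayer κ 0) // (2 : ℕ) • x = 0} = 2) →
      Nat.card (W'.selmerGroup 2) = 2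

/-- B4 (Gross–Zagier–Kolyvagin + Mordell–Weil, in print): analytic rank `1` ⇒ some rational affine point is not `2`-divisible in `W'(ℚ)`. -/
def AnalyticRankOneGivesNonDoubledPoint : Prop :=
  ∀ (W' : WeierstrassCurve ℚ) [W'.IsElliptic], W'.analyticRank = 1 →
    ∃ (x y : ℚ) (hq : W'.toAffine.Nonsingular x y),
      (W'.baseChange ℚ_[2]).toAffine.Nonsingular (algebraMap ℚ ℚ_[2] x) (algebraMap ℚ ℚ_[2] y) ∧
      ¬ ∃ R : W'.toAffine.Point, R + R = WeierstrassCurve.Affine.Point.some x y hq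

/-- **Kernel glue 1: P50f″ = B1 (BSD₂ slice) ∘ [T₂-card + P50f‴ + B0 + B3] — everything but B1 is theorem-grade.** -/
theorem oddTwistSha_of_cores (hT : TwistByTwoSelmerCardTrichotomyAtTwo) (hD : TwistByTwoDivisibleAtTwoOfHalvedSelmer)
    (hB0 : OddTamagawaSilencesInertPrimes) (hB1 : EvenLValueForcesSelmerFourAtTwo) (hB3 : LayerZeroTwoTorsionCardIsSelmerTwoCard) :
    TwistByTwoPointTwoDivisibleAtTwoOfOddTwistSha := by
  intro W _ _ hgood ha2 ht htam W' _ hC _hrk hsel x y hns hxy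
  have hsil : InertPrimesSilentAtTwo W := hB0 W htam
  have h4 : 4 ≤ Nat.card (W.selmerGroup 2) := hB1 W hgood ha2 ht htam
  have h2 : Nat.card (W'.selmerGroup 2) = 2 := hB3 W hgood ha2 W' hC hsel
  rcases hT W hgood ha2 hsil W' hC with h | h | h
  · omega
  · exact hD W hgood ha2 hsil W' hC h x y hns hxy
  · omega

/-- P50f′ on its α-sub-population (inert primes silent, e.g. the even Tamagawa number sits at a prime `≡ ±1 (8)`). -/
@[conjecture] def TwistByTwoPointNotTwoDivisibleAtTwoOfHalfUnitAlpha : Prop :=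
  ∀ (W : WeierstrassCurve ℚ) [W.IsElliptic] [W.IsGloballyMinimal],
    W.HasGoodReductionAtPrime 2 → (2 : ℤ) ∣ W.frobeniusTrace 2 → InertPrimesSilentAtTwo W →
    (∃ t : ℚ, W.entireLFunction 1 / (W.realPeriodRat : ℂ) = (t : ℂ) ∧ t ≠ 0 ∧ padicValRat 2 t = 1) →
    ∀ (W' : WeierstrassCurve ℚ) [W'.IsElliptic],
      (∃ C : VariableChange ℚ, C • W.quadraticTwist 2 = W') → W'.analyticRank = 1 →
      ∃ (x y : ℚ) (h : (W'.baseChange ℚ_[2]).toAffine.Nonsingular (algebraMap ℚ ℚ_[2] x) (algebraMap ℚ ℚ_[2] y)),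
        W'.toAffine.Nonsingular x y ∧
          ¬ ∃ Q : (W'.baseChange ℚ_[2]).toAffine.Point,
            Q + Q = WeierstrassCurve.Affine.Point.some (algebraMap ℚ ℚ_[2] x) (algebraMap ℚ ℚ_[2] y) h

/-- **Kernel glue 2: P50f′-α = B1′ (BSD₂ slice) ∘ [P50e‴ + B4].** (P50f′ itself = α ∧ β; β = an inert prime NOT silent — there T₂ is mute.) -/
theorem halfUnitAlpha_of_cores (hP : TwistByTwoPrimitiveAtTwoOfTrivialSelmer) (hB1 : HalfUnitLValueForcesSelmerTrivialAtTwo)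
    (hB4 : AnalyticRankOneGivesNonDoubledPoint) : TwistByTwoPointNotTwoDivisibleAtTwoOfHalfUnitAlpha := by
  intro W _ _ hgood ha2 hsil ht W' _ hC hrk
  have h1 : Nat.card (W.selmerGroup 2) = 1 := hB1 W hgood ha2 ht
  obtain ⟨x, y, hq, h, hR⟩ := hB4 W' hrk
  exact ⟨x, y, h, hq, hP W hgood ha2 hsil h1 W' hC x y hq h hR⟩

/-- Glue 3 (trivial): P50f′ ⇒ P50f′-α. -/
theorem halfUnitAlpha_of_halfUnit (h : TwistByTwoPointNotTwoDivisibleAtTwoOfHalfUnit) :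
    TwistByTwoPointNotTwoDivisibleAtTwoOfHalfUnitAlpha := by
  intro W _ _ hgood ha2 _hsil ht W' _ hC hrk
  exact h W hgood ha2 ht W' hC hrk

/-- **T₂-dichotomy `TwistByTwoSelmerCardDichotomyAtTwo`** (THEOREM-grade, uses the local parity lemma [Kramer1981 Thm 1 =
MazurRubin2010 Thm 2.7 = KMR2013 Thm 3.9, tree]: `d₂(W') - d₂(W) ≡ Σ_v h_v = h₂ = 1 (mod 2)` on `T_eff = {2}`, which kills the third
line `Λ ∉ {L₂, L'₂}` of the trichotomy): `#Sel₂(W') = 2·#Sel₂(W)` or `2·#Sel₂(W') = #Sel₂(W)`. -/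
def TwistByTwoSelmerCardDichotomyAtTwo : Prop :=
  ∀ (W : WeierstrassCurve ℚ) [W.IsElliptic] [W.IsGloballyMinimal],
    W.HasGoodReductionAtPrime 2 → (2 : ℤ) ∣ W.frobeniusTrace 2 → InertPrimesSilentAtTwo W →
    ∀ (W' : WeierstrassCurve ℚ) [W'.IsElliptic],
      (∃ C : VariableChange ℚ, C • W.quadraticTwist 2 = W') →
        Nat.card (W'.selmerGroup 2) = 2 * Nat.card (W.selmerGroup 2) ∨
        2 * Nat.card (W'.selmerGroup 2) = Nat.card (W.selmerGroup 2)

/-- Kernel: dichotomy ⇒ trichotomy. -/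
theorem trichotomy_of_dichotomy (h : TwistByTwoSelmerCardDichotomyAtTwo) : TwistByTwoSelmerCardTrichotomyAtTwo := by
  intro W _ _ hgood ha2 hsil W' _ hC
  rcases h W hgood ha2 hsil W' hC with h1 | h2
  · exact Or.inl h1
  · exact Or.inr (Or.inl h2)

/-- Kernel (P151-3 arithmetic): dichotomy with `#Sel₂(W') = 2` (i.e. `d₂(W^{(2)}) = 1`) pins `#Sel₂(W) ∈ {1, 4}`: for rank-0 `W` this is
`Ш(W)[2] = 0` or `Ш(W)[2] ≅ (ℤ/2)²` — never `(ℤ/2)⁴`; so a Tam-odd `W` with `Ш_an(W) = 16` and `d₂(W^{(2)}) = 1` must have `Ш(W)[2^∞] ≅ (ℤ/4)²`. -/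
theorem selmer_card_of_dichotomy_of_twist_two (a b : ℕ) (h : b = 2 * a ∨ 2 * b = a) (hb : b = 2) : a = 1 ∨ a = 4 := by
  omega

/-! ## ♭-cores (parity-silenced hypothesis): the full P50f′, β-sub-population included.
Words-proof of the silencing: `h₂ = 1` for EVERY curve good supersingular at `2` (J151 below: `Δ_min ≡ 5 (mod 8)`, so `(Δ,2)_{ℚ₂} = -1`,
and [Kramer1981 Prop. 4]: `F = ℚ₂`, `K = ℚ₂(√2)`, `v(d) = 1` odd ⇒ `i(K/F) = [F:ℚ₂] = 1`); Kramer parity [Kramer1981 Thm 1 = MazurRubin2010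
Thm 2.7, tree `KMR2013 Thm 3.9`]: `Σ_v h_v ≡ d₂(W) + d₂(W') (mod 2)`; `d₂(W) = 0` here and `d₂(W') = 1 + dim Ш(W')[2]` is odd (GZK: analytic
rank 1 ⇒ rank 1, `Ш(W')` finite; Cassels–Tate alternating); `∞` and split primes have `h = 0`; an odd-`c_p` inert prime has `h_p = 0` (B0 +
MR Lemma 2.10 (ii)/(iii)); so `v₂(Tam W) ≤ 1` leaves at most ONE candidate mover `p₀` and parity forces `h_{p₀} = 1 - h₂ = 0`: `T_eff = {2}`. -/

/-- **P50e‴♭ `TwistByTwoPrimitiveAtTwoOfTrivialSelmerOfTamagawa`** (THEOREM-grade, uses parity): as P50e‴ with `InertPrimesSilentAtTwo W`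
replaced by `v₂(Tam W) ≤ 1` and `W'.analyticRank = 1` added (finiteness/parity input). Covers P50e's and P50f′'s whole loci. -/
def TwistByTwoPrimitiveAtTwoOfTrivialSelmerOfTamagawa : Prop :=
  ∀ (W : WeierstrassCurve ℚ) [W.IsElliptic] [W.IsGloballyMinimal],
    W.HasGoodReductionAtPrime 2 → (2 : ℤ) ∣ W.frobeniusTrace 2 → padicValNat 2 W.tamagawaProduct ≤ 1 →
    Nat.card (W.selmerGroup 2) = 1 →
    ∀ (W' : WeierstrassCurve ℚ) [W'.IsElliptic],
      (∃ C : VariableChange ℚ, C • W.quadraticTwist 2 = W') → W'.analyticRank = 1 →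
      ∀ (x y : ℚ) (hq : W'.toAffine.Nonsingular x y)
        (h : (W'.baseChange ℚ_[2]).toAffine.Nonsingular (algebraMap ℚ ℚ_[2] x) (algebraMap ℚ ℚ_[2] y)),
        (¬ ∃ R : W'.toAffine.Point, R + R = WeierstrassCurve.Affine.Point.some x y hq) →
          ¬ ∃ Q : (W'.baseChange ℚ_[2]).toAffine.Point,
            Q + Q = WeierstrassCurve.Affine.Point.some (algebraMap ℚ ℚ_[2] x) (algebraMap ℚ ℚ_[2] y) h

/-- B1′♭ (**the BSD₂(W) slice behind the full P50f′**, CONJECTURE): `ord₂(L(W,1)/Ω_W) = 1` ⇒ `#Sel₂(W) = 1` and `v₂(Tam W) ≤ 1`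
(BSD: `ord₂(L/Ω) = v₂(Tam) + v₂(#Ш) - 2 v₂(#W(ℚ)_tors)`, `W(ℚ)[2] = 0`, `#Ш` a square). -/
@[conjecture] def HalfUnitLValueForcesSelmerTrivialAndTamagawaAtTwo : Prop :=
  ∀ (W : WeierstrassCurve ℚ) [W.IsElliptic] [W.IsGloballyMinimal],
    W.HasGoodReductionAtPrime 2 → (2 : ℤ) ∣ W.frobeniusTrace 2 →
    (∃ t : ℚ, W.entireLFunction 1 / (W.realPeriodRat : ℂ) = (t : ℂ) ∧ t ≠ 0 ∧ padicValRat 2 t = 1) →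
    Nat.card (W.selmerGroup 2) = 1 ∧ padicValNat 2 W.tamagawaProduct ≤ 1

/-- **Kernel glue 2♭: the FULL P50f′ = B1′♭ (BSD₂ slice) ∘ [P50e‴♭ + B4]** — everything but B1′♭ is theorem-grade (in-print assembly). -/
theorem halfUnit_of_cores (hP : TwistByTwoPrimitiveAtTwoOfTrivialSelmerOfTamagawa)
    (hB1 : HalfUnitLValueForcesSelmerTrivialAndTamagawaAtTwo) (hB4 : AnalyticRankOneGivesNonDoubledPoint) :
    TwistByTwoPointNotTwoDivisibleAtTwoOfHalfUnit := by
  intro W _ _ hgood ha2 ht W' _ hC hrk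
  obtain ⟨h1, htam⟩ := hB1 W hgood ha2 ht
  obtain ⟨x, y, hq, h, hR⟩ := hB4 W' hrk
  exact ⟨x, y, h, hq, hP W hgood ha2 htam h1 W' hC hrk x y hq h hR⟩

/-! ## Kernel brick J151: good supersingular reduction at `2` ⇒ `Δ_min ≡ 5 (mod 8)` (so `(Δ, 2)_{ℚ₂} = −1`, Kramer 1981 Prop. 4:
the local norm index of `ℚ₂(√2)/ℚ₂` on `W(ℚ₂)` is `1`, i.e. `h₂ = 1` for EVERY such curve). Model-theoretic input in words: on a minimal
model, supersingular reduction at `2` ⟺ `ā₁ = 0` (the only supersingular `j` in characteristic `2` is `0 = ā₁¹²/Δ̄`) and then smoothness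
forces `ā₃ ≠ 0`; so `a₁ = 2s`, `a₃ = 2t + 1`. The algebra: -/

/-- J151 algebra (REF1 §151, kernel `ring`): the discriminant of `[2s, a₂, 2t+1, a₄, a₆]` is `8·(…) + 5`. -/
theorem delta_eq_eight_mul_add_five (s a₂ t a₄ a₆ : ℤ) :
    (WeierstrassCurve.mk (2*s) a₂ (2*t+1) a₄ a₆).Δ
      = 8 * ( -2*(s^2+a₂)^2*(4*s^2*a₆ + 4*a₂*a₆ - 2*s*(2*t+1)*a₄ + a₂*(2*t+1)^2 - a₄^2)
              - 8*(a₄ + s*(2*t+1))^3 - 4 - 27*(t^2+t+a₆) - 54*(t^2+t+a₆)^2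
              + 9*(s^2+a₂)*(a₄ + s*(2*t+1))*(1+4*(t^2+t+a₆)) ) + 5 := by
  simp only [WeierstrassCurve.Δ, WeierstrassCurve.b₂, WeierstrassCurve.b₄, WeierstrassCurve.b₆, WeierstrassCurve.b₈]
  ring

/-- J151: `a₁` even, `a₃` odd ⇒ `Δ ≡ 5 (mod 8)` (census151: 45 202/45 202 rank-0 curves good supersingular at 2 with `N ≡ ±3 (8)`, N < 5·10⁵). -/
theorem delta_emod_eight_of_even_a1_odd_a3 (s a₂ t a₄ a₆ : ℤ) :
    (WeierstrassCurve.mk (2*s) a₂ (2*t+1) a₄ a₆).Δ % 8 = 5 := by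
  rw [delta_eq_eight_mul_add_five]; omega

end Summit.BirchSwinnertonDyer.Rank1Residual.F1Sign2
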